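import Mathlib
import Summits.ResolutionOfSingularities.ResolutionOfSingularities.Theorems.WildQuotientsWildQuotientResolutionTranslationInvariants

/-!
# V3U chart a, step (iii): fixed points of the pure translation `x_b ↦ x_b + x_a` on `k[x]` are `k[N, xᵢ (i ≠ b)]`

(crux stmt-ResolutionOfSingularities-15640 `WildQuotients.WildQuotientResolution`, line `Sketch`,
sector `|G| = p`; programme V3U «toric exit» of `L/w45c/CHAIN.md` v5 §4 row stub-1, step (iii) of
C2 `chartA_fixedPoints_eq` (transport of B1 `ToricExit.fixedPoints_translate`, p486502, from
`A[X]` to `MvPolynomial (Fin n) k`); [OURS · L1 W4.5c] — NOT a statement of any manuscript;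
replaces the role of no printed item.)

Let `τ` be the `k`-algebra endomorphism of `U = k[x₀,…,x_{n-1}]` with `τ x_b = x_b + x_a` and
`τ xᵢ = xᵢ` for `i ≠ b` (`a ≠ b`), over a field of prime characteristic `p`. Then
(`mem_adjoin_of_translate_eq`) every `τ`-fixed `f` lies in
`k[N, xᵢ (i ≠ b)] = Algebra.adjoin k ({N} ∪ {xᵢ : i ≠ b})`, `N = x_b^p − x_a^{p−1} x_b`.
Proof: `U ≅ A[X]`, `A = k[xᵢ : i ≠ b]` (`MvPolynomial.renameEquiv` along `Equiv.optionSubtypeNe b`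
+ `MvPolynomial.optionEquivLeft`), under which `τ` becomes `Polynomial.algEquivAevalXAddC x_a`
(`translate_transport`); B1 gives `A[N_A]`, and the inverse isomorphism maps `A[N_A]` into
`k[N, xᵢ (i ≠ b)]` (`symm_aeval_mem_adjoin`).
-/

-- single-problem summit: the doubled namespace component `ResolutionOfSingularities` is forced
set_option linter.dupNamespace false

noncomputable section

open MvPolynomial

namespace Summit.ResolutionOfSingularities.ResolutionOfSingularities.Theorems.WildQuotientResolution.ToricExit

variable (k : Type) [Field k] (n : ℕ) (a b : Fin n) (hab : a ≠ b)

/-- The variable `x_b` goes to `Polynomial.X` under `U ≅ A[X]`. [folklore] -/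
theorem splitEquiv_X_self :
    ((renameEquiv k (Equiv.optionSubtypeNe b).symm).trans
        (optionEquivLeft k {i : Fin n // i ≠ b})) (X b) = Polynomial.X := by
  rw [AlgEquiv.trans_apply, renameEquiv_apply, rename_X, Equiv.optionSubtypeNe_symm_self,
    optionEquivLeft_X_none]

/-- The variables `xᵢ`, `i ≠ b`, go to the constants `C xᵢ` under `U ≅ A[X]`. [folklore] -/
theorem splitEquiv_X_of_ne (i : Fin n) (hi : i ≠ b) :
    ((renameEquiv k (Equiv.optionSubtypeNe b).symm).trans
        (optionEquivLeft k {i : Fin n // i ≠ b})) (X i) = Polynomial.C (X ⟨i, hi⟩) := by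
  rw [AlgEquiv.trans_apply, renameEquiv_apply, rename_X, Equiv.optionSubtypeNe_symm_of_ne hi,
    optionEquivLeft_X_some]

/-- The inverse of `U ≅ A[X]` sends `Polynomial.X` to `x_b`. [folklore] -/
theorem splitEquiv_symm_X :
    ((renameEquiv k (Equiv.optionSubtypeNe b).symm).trans
        (optionEquivLeft k {i : Fin n // i ≠ b})).symm Polynomial.X = X b := by
  rw [AlgEquiv.symm_trans_apply, optionEquivLeft_symm_X, renameEquiv_symm, renameEquiv_apply,
    rename_X, Equiv.symm_symm, Equiv.optionSubtypeNe_none]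

/-- The inverse of `U ≅ A[X]` sends `C xⱼ` to `x_j`. [folklore] -/
theorem splitEquiv_symm_C_X (j : {i : Fin n // i ≠ b}) :
    ((renameEquiv k (Equiv.optionSubtypeNe b).symm).trans
        (optionEquivLeft k {i : Fin n // i ≠ b})).symm (Polynomial.C (X j)) = X j.1 := by
  rw [AlgEquiv.symm_trans_apply, optionEquivLeft_symm_C_X, renameEquiv_symm, renameEquiv_apply,
    rename_X, Equiv.symm_symm, Equiv.optionSubtypeNe_some]

/-- The inverse of `U ≅ A[X]` maps constants `C x`, `x ∈ A = k[xᵢ : i ≠ b]`, into `k[N, xᵢ (i ≠ b)]`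
(indeed into `k[xᵢ : i ≠ b]`). [folklore] -/
theorem splitEquiv_symm_C_mem_adjoin (p : ℕ) (x : MvPolynomial {i : Fin n // i ≠ b} k) :
    ((renameEquiv k (Equiv.optionSubtypeNe b).symm).trans
        (optionEquivLeft k {i : Fin n // i ≠ b})).symm (Polynomial.C x) ∈
      Algebra.adjoin k (({X b ^ p - X a ^ (p - 1) * X b} : Set (MvPolynomial (Fin n) k)) ∪
        ((fun i => X i) '' {i | i ≠ b})) := by
  set T := Algebra.adjoin k (({X b ^ p - X a ^ (p - 1) * X b} : Set (MvPolynomial (Fin n) k)) ∪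
    ((fun i => X i) '' {i | i ≠ b})) with hT
  induction x using MvPolynomial.induction_on with
  | C r =>
    rw [AlgEquiv.symm_trans_apply, optionEquivLeft_symm_C_C, renameEquiv_symm,
      renameEquiv_apply, rename_C]
    exact T.algebraMap_mem r
  | add x y hx hy =>
    rw [map_add, map_add]
    exact T.add_mem hx hy
  | mul_X x j hx =>
    rw [map_mul, map_mul, splitEquiv_symm_C_X]
    exact T.mul_mem hx (Algebra.subset_adjoin (Or.inr ⟨j.1, j.2, rfl⟩))

/-- The inverse of `U ≅ A[X]` sends the Artin–Schreier element `N_A = X^p − x_a^{p−1} X` to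
`N = x_b^p − x_a^{p−1} x_b`. [folklore] -/
theorem splitEquiv_symm_artinSchreier (p : ℕ) :
    ((renameEquiv k (Equiv.optionSubtypeNe b).symm).trans
        (optionEquivLeft k {i : Fin n // i ≠ b})).symm
        (Polynomial.X ^ p - Polynomial.C ((X ⟨a, hab⟩ : MvPolynomial {i : Fin n // i ≠ b} k) ^
          (p - 1)) * Polynomial.X) =
      (X b ^ p - X a ^ (p - 1) * X b : MvPolynomial (Fin n) k) := by
  rw [map_sub, map_pow, map_mul, splitEquiv_symm_X, map_pow, map_pow, splitEquiv_symm_C_X]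

/-- **The inverse of `U ≅ A[X]` maps `A[N_A]` into `k[N, xᵢ (i ≠ b)]`.** [folklore] -/
theorem splitEquiv_symm_aeval_mem_adjoin (p : ℕ) (q : Polynomial (MvPolynomial {i : Fin n // i ≠ b} k)) :
    ((renameEquiv k (Equiv.optionSubtypeNe b).symm).trans
        (optionEquivLeft k {i : Fin n // i ≠ b})).symm
        (Polynomial.aeval (R := MvPolynomial {i : Fin n // i ≠ b} k)
          (Polynomial.X ^ p - Polynomial.C ((X ⟨a, hab⟩ : MvPolynomial {i : Fin n // i ≠ b} k) ^
            (p - 1)) * Polynomial.X) q) ∈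
      Algebra.adjoin k (({X b ^ p - X a ^ (p - 1) * X b} : Set (MvPolynomial (Fin n) k)) ∪
        ((fun i => X i) '' {i | i ≠ b})) := by
  set T := Algebra.adjoin k (({X b ^ p - X a ^ (p - 1) * X b} : Set (MvPolynomial (Fin n) k)) ∪
    ((fun i => X i) '' {i | i ≠ b})) with hT
  have hN : (X b ^ p - X a ^ (p - 1) * X b : MvPolynomial (Fin n) k) ∈ T :=
    Algebra.subset_adjoin (Or.inl rfl)
  induction q using Polynomial.induction_on' with
  | add q₁ q₂ h₁ h₂ =>
    rw [map_add, map_add]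
    exact T.add_mem h₁ h₂
  | monomial j x =>
    rw [Polynomial.aeval_monomial, Polynomial.algebraMap_eq, map_mul, map_pow,
      splitEquiv_symm_artinSchreier]
    exact T.mul_mem (splitEquiv_symm_C_mem_adjoin k n a b p x) (T.pow_mem hN j)

/-- **Transport of the translation**: under `U ≅ A[X]` the substitution `x_b ↦ x_b + x_a`
(`xᵢ ↦ xᵢ` otherwise) becomes `Polynomial.algEquivAevalXAddC x_a` (`X ↦ X + x_a`). [folklore] -/
theorem splitEquiv_translate (f : MvPolynomial (Fin n) k) :
    ((renameEquiv k (Equiv.optionSubtypeNe b).symm).trans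
        (optionEquivLeft k {i : Fin n // i ≠ b}))
        (aeval (fun i : Fin n => if i = b then X b + X a else (X i : MvPolynomial (Fin n) k)) f) =
      Polynomial.algEquivAevalXAddC (X ⟨a, hab⟩ : MvPolynomial {i : Fin n // i ≠ b} k)
        (((renameEquiv k (Equiv.optionSubtypeNe b).symm).trans
          (optionEquivLeft k {i : Fin n // i ≠ b})) f) := by
  classical
  set Φ := (renameEquiv k (Equiv.optionSubtypeNe b).symm).trans
    (optionEquivLeft k {i : Fin n // i ≠ b}) with hΦ
  set τ : MvPolynomial (Fin n) k →ₐ[k] MvPolynomial (Fin n) k :=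
    aeval (fun i : Fin n => if i = b then X b + X a else (X i : MvPolynomial (Fin n) k)) with hτ
  set T := (Polynomial.algEquivAevalXAddC
    (X ⟨a, hab⟩ : MvPolynomial {i : Fin n // i ≠ b} k)).restrictScalars k with hT
  have key : Φ.toAlgHom.comp τ = T.toAlgHom.comp Φ.toAlgHom := by
    refine MvPolynomial.algHom_ext fun i => ?_
    change Φ (τ (X i)) = T (Φ (X i))
    rw [hτ, aeval_X]
    by_cases hib : i = b
    · subst hib
      rw [if_pos rfl, map_add, hΦ, splitEquiv_X_self, splitEquiv_X_of_ne k n i a hab, hT,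
        AlgEquiv.restrictScalars_apply, Polynomial.algEquivAevalXAddC_apply, Polynomial.aeval_X]
    · rw [if_neg hib, hΦ, splitEquiv_X_of_ne k n b i hib, hT, AlgEquiv.restrictScalars_apply,
        Polynomial.algEquivAevalXAddC_apply, Polynomial.aeval_C, Polynomial.algebraMap_eq]
  have h := congrArg (fun φ : MvPolynomial (Fin n) k →ₐ[k] _ => φ f) key
  exact h

include hab in
/-- **Fixed points of the translation `x_b ↦ x_b + x_a` lie in `k[N, xᵢ (i ≠ b)]`**,
`N = x_b^p − x_a^{p−1} x_b` (prime characteristic `p`): transport to `A[X]` (`splitEquiv_translate`),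
apply B1 `fixedPoints_translate` (the constant `x_a ∈ A` is a non-zero-divisor), and come back
(`splitEquiv_symm_aeval_mem_adjoin`). [OURS · L1 W4.5c] [folklore: Artin–Schreier] -/
theorem mem_adjoin_of_translate_eq (p : ℕ) (hp : p.Prime) [CharP k p]
    (f : MvPolynomial (Fin n) k)
    (hf : aeval (fun i : Fin n => if i = b then X b + X a else (X i : MvPolynomial (Fin n) k)) f = f) :
    f ∈ Algebra.adjoin k (({X b ^ p - X a ^ (p - 1) * X b} : Set (MvPolynomial (Fin n) k)) ∪
        ((fun i => X i) '' {i | i ≠ b})) := by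
  haveI : Fact p.Prime := ⟨hp⟩
  set Φ := (renameEquiv k (Equiv.optionSubtypeNe b).symm).trans
    (optionEquivLeft k {i : Fin n // i ≠ b}) with hΦ
  have hρ : (X ⟨a, hab⟩ : MvPolynomial {i : Fin n // i ≠ b} k) ∈
      nonZeroDivisors (MvPolynomial {i : Fin n // i ≠ b} k) :=
    mem_nonZeroDivisors_of_ne_zero (X_ne_zero _)
  have h1 : Polynomial.algEquivAevalXAddC (X ⟨a, hab⟩ : MvPolynomial {i : Fin n // i ≠ b} k) (Φ f) =
      Φ f := by
    rw [hΦ, ← splitEquiv_translate k n a b hab f, hf]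
  obtain ⟨q, hq⟩ := (AlgHom.mem_range _).mp
    ((fixedPoints_translate p (MvPolynomial {i : Fin n // i ≠ b} k) (X ⟨a, hab⟩) hρ (Φ f)).mp h1)
  have hfq : f = Φ.symm (Polynomial.aeval (R := MvPolynomial {i : Fin n // i ≠ b} k)
      (Polynomial.X ^ p - Polynomial.C ((X ⟨a, hab⟩ : MvPolynomial {i : Fin n // i ≠ b} k) ^
        (p - 1)) * Polynomial.X) q) := by
    rw [hq, AlgEquiv.symm_apply_apply]
  rw [hfq, hΦ]
  exact splitEquiv_symm_aeval_mem_adjoin k n a b hab p q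

end Summit.ResolutionOfSingularities.ResolutionOfSingularities.Theorems.WildQuotientResolution.ToricExit

end
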